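import Literature.MathematicalPhysics.QuantumLattice.HubbardTorusMarkovPressureClusterBound
import Literature.MathematicalPhysics.QuantumLattice.HubbardTorusMarkovPressureTorusLimit
import HarnessLib

/-!
# The certified upper edge of the thermal energy window from a weighted-cluster Markov certificate,
# with the cold free-energy input discharged by the ground-state energy density

Topic `MathematicalPhysics/QuantumLattice`, namespace `Literature.MathematicalPhysics.QuantumLattice`.

`HubbardTorusMarkovPressureTorusLimit.lean` turns a finite-volume Markov pressure certificate at a hot `β_h`
(window ⊇ a `3 × 3` translate, representative `Γ(τ_z E_Φ)`) into `e_Φ(ω) ≤ (c − β_h μ n − ℓ)/(β − β_h)` for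
every torus limit `ω` of the canonical sector Gibbs states at `β > β_h`, GIVEN a cold input
`ℓ L² ≤ log Z_β^{sector}(L)` eventually. Here:
* §1 `eventually_log_partitionFn_sectorHamiltonianTT'_le_of_linear`: a LINEAR finite-volume bound
  `log Z_{β_h}(H − μN) ≤ c L² + C L` gives the eventual sector bound `(c − β_h μ n + ε) L²`
  (`log Z^{sector} ≤ log Z(H − μN) − β_h μ N_{sector}`, [cite: Ruelle1969, §3.4]);
* §2 `eventually_log_partitionFn_sectorHamiltonianTT'_le_of_clusterCertificate`: the WEIGHTED-CLUSTER
  certificate of `HubbardTorusMarkovPressureClusterBound.lean` (`t' = 0`; windows as small as a corner — the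
  programme's `3 × 2`, `4 × 2`, staircase shields) is such a linear bound;
* §3 THE COLD INPUT IS DISCHARGED: for `U ≥ 0`, `0 ≤ n < 2`, `β ≥ 0`, `ε > 0`, eventually
  `−β (e(t,t',U,n) + ε) L² ≤ log Z_β^{sector}(L)` (`Z ≥ e^{−βE₀}` [cite: GustafsonSigal2003, §18.3 Theorem 18.10],
  the sector ground energy is the `rectN n L`-particle one, `E₀(L)/L² → e = energyDensityTT'`);
* §4 HEADLINES: for every torus limit `ω` of the sector Gibbs states at `β`, `0 < β_h < β`, a `T = 0` row
  `e(t,t',U,n) ≤ e⁺` and a Markov certificate with constant `c` at `(β_h, μ)`: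
  `e_Φ(ω) ≤ (c − β_h μ n + β e⁺)/(β − β_h)` — `E_Φ` representative for every `t'`
  (`…of_markov_certificate_of_energyDensityTT'_le`), weighted-cluster / corner representative with a
  structured annihilator at `t' = 0` (`…of_clusterMarkovCertificate[_annihilator]`, `…of_cornerMarkovCertificate`).
  The only hypotheses left are the matrix certificate (a finite-dimensional PSD claim) and the `T = 0` row.
Hot anchor: [cite: PoulinHastings2011, eqs. (3)–(8)]; chords: [cite: Israel1979, Lemma II.3.1]. Everything is
PROVED; no definition, no named fact.
-/

noncomputable section

namespace Literature.MathematicalPhysics.QuantumLattice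

open Matrix Finset HubbardWave0 Literature.Probability.LatticeModels ThermodynamicLimit AndersonCluster
open _root_.Filter
open scoped _root_.Topology ComplexOrder MatrixOrder

/-! ### §1. Linear grand-canonical pressure bounds pass to the canonical sector -/

section Torus

/-- (Local.) As in `HubbardTorusMarkovPressureTorusLimit.lean`: at the torus, orbital equality is decided
through the linear order. [folklore] -/
local instance (priority := high) instDecidableEqOrbFermionTorusClusterTL (L : ℕ) :
    DecidableEq (Orb (FermionTorus 2 L)) :=
  LinearOrder.toDecidableEq

/-- `rectN n L` is within `2` of `n L²`. [cite: Ruelle1969, §3.4] -/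
theorem abs_rectN_sub_mul_sq_le {n : ℝ} (hn0 : 0 ≤ n) (L : ℕ) :
    |((rectN n L : ℕ) : ℝ) - n * (L : ℝ) ^ 2| ≤ 2 := by
  have hx : 0 ≤ n * (L : ℝ) ^ 2 / 2 := by positivity
  have h1 := Nat.floor_le hx
  have h2 := Nat.lt_floor_add_one (n * (L : ℝ) ^ 2 / 2)
  rw [rectN, Nat.cast_mul, Nat.cast_two, abs_le]
  constructor <;> nlinarith

/-- **A linear finite-volume bound on the grand-canonical pressure gives an eventual per-volume bound on
the canonical pressure.** If `log Z_{β_h}(H^{tt'}_L − μN_L) ≤ c L² + C L` for all `L ≥ L₀`, then for every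
density `n ∈ [0,2]`, every `Ls → ∞` and every `ε > 0`, eventually
`log Z_{β_h}(sectorHamiltonianTT' t t' U n (Ls j)) ≤ (c − β_h μ n + ε) (Ls j)²`
(`log Z^{sector} ≤ log Z(H − μN) − β_h μ · rectN n L`, `|rectN n L − n L²| ≤ 2`).
[cite: Ruelle1969, §3.4] -/
theorem eventually_log_partitionFn_sectorHamiltonianTT'_le_of_linear (t t' U μ βh : ℝ) {n : ℝ}
    (hn0 : 0 ≤ n) (hn2 : n ≤ 2) {Ls : ℕ → ℕ} (hLs : Tendsto Ls atTop atTop) {c C : ℝ} {L₀ : ℕ}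
    (hGC : ∀ L : ℕ, L₀ ≤ L →
      Real.log (partitionFn βh (hubbardTorusTT' L t t' U - (μ : ℂ) • totalNumber)).re ≤
        c * (L : ℝ) ^ 2 + C * (L : ℝ))
    {ε : ℝ} (hε : 0 < ε) :
    ∀ᶠ j in atTop, Real.log (partitionFn βh (sectorHamiltonianTT' t t' U n (Ls j))).re ≤
      (c - βh * μ * n + ε) * (Ls j : ℝ) ^ 2 := by
  have hev : ∀ᶠ j in atTop, L₀ ≤ Ls j ∧ |C| * (Ls j : ℝ) + 2 * |βh * μ| ≤ ε * (Ls j : ℝ) ^ 2 := by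
    have h1 := hLs.eventually_ge_atTop (max L₀ 1)
    have h2 : Tendsto (fun j => (Ls j : ℝ)) atTop atTop := tendsto_natCast_atTop_atTop.comp hLs
    have h3 := h2.eventually_ge_atTop ((|C| + 2 * |βh * μ|) / ε + 1)
    filter_upwards [h1, h3] with j hj hj'
    refine ⟨le_of_max_le_left hj, ?_⟩
    have hL1 : (1 : ℝ) ≤ (Ls j : ℝ) := by exact_mod_cast le_of_max_le_right hj
    have hCε : |C| + 2 * |βh * μ| ≤ ε * (Ls j : ℝ) := by
      have := (div_le_iff₀ hε).1 (by linarith : (|C| + 2 * |βh * μ|) / ε ≤ (Ls j : ℝ))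
      linarith [this]
    nlinarith [hCε, hL1, abs_nonneg C, abs_nonneg (βh * μ)]
  filter_upwards [hev] with j ⟨hj0, hjε⟩
  have hM := hGC (Ls j) hj0
  have hcomp0 := log_partitionFn_sectorHamiltonianTT'_le_grandCanonical t t' U hn0 hn2 (Ls j) βh μ
  have hcomp : Real.log (partitionFn βh (sectorHamiltonianTT' t t' U n (Ls j))).re ≤
      Real.log (partitionFn βh (hubbardTorusTT' (Ls j) t t' U - (μ : ℂ) • totalNumber)).re -
        βh * μ * ((rectN n (Ls j) : ℕ) : ℝ) := by
    convert hcomp0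
  have hμ : -(βh * μ * ((rectN n (Ls j) : ℕ) : ℝ)) ≤ -(βh * μ * n) * (Ls j : ℝ) ^ 2 + 2 * |βh * μ| := by
    have hr := abs_rectN_sub_mul_sq_le hn0 (Ls j)
    have : |βh * μ * (((rectN n (Ls j) : ℕ) : ℝ) - n * (Ls j : ℝ) ^ 2)| ≤ |βh * μ| * 2 := by
      rw [abs_mul]
      exact mul_le_mul_of_nonneg_left hr (abs_nonneg _)
    have h' := (abs_le.1 this).1
    nlinarith [h']
  have hCL : C * (Ls j : ℝ) ≤ |C| * (Ls j : ℝ) := mul_le_mul_of_nonneg_right (le_abs_self C) (Nat.cast_nonneg _)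
  linarith [hM, hcomp, hμ, hCL, hjε]

/-! ### §2. The weighted-cluster certificate (`t' = 0`) as the hot anchor -/

/-- **Eventual per-volume bound on the canonical pressure from a weighted-cluster Markov certificate**
(`t' = 0`): window `Λ ⊆ [0,ℓ_w)²` with lexicographically largest site `a`, NORMALISED weights `(J, V, μ')`,
a Hermitian `G ∈ 𝔄_Λ` of zero expectation in the window marginal of the grand-canonical Gibbs density for
every torus side `L ≥ 3, ℓ_w`, and a dual `(L_B, c)` passing the certificate for `h = β_h (h(J,V,μ') + G)`;
then for every `ε > 0`, eventually `log Z_{β_h}(sectorHamiltonianTT' t 0 U n (Ls j)) ≤ (c − β_h μ n + ε) (Ls j)²`.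
[cite: PoulinHastings2011, eqs. (3)–(8)] [cite: Ruelle1969, §3.4] -/
theorem eventually_log_partitionFn_sectorHamiltonianTT'_le_of_clusterCertificate (t U μ βh : ℝ) {n : ℝ}
    (hn0 : 0 ≤ n) (hn2 : n ≤ 2) {Ls : ℕ → ℕ} (hLs : Tendsto Ls atTop atTop)
    {Λ : Finset (Site 2)} {a : Site 2} (ha : a ∈ Λ) (hmax : ∀ y ∈ Λ, toLex y ≤ toLex a)
    {ℓw : ℕ} (hΛ : Λ ⊆ halfOpenBox 2 ℓw)
    {J : Site 2 → Fin 2 → ℝ} {V μ' : Site 2 → ℝ}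
    (hJ : ∀ i, bondWeightSum Λ J i = 1) (hV : siteWeightSum Λ V = 1) (hμ : siteWeightSum Λ μ' = -μ)
    {G : FermionOp Λ} (hG : G.IsHermitian)
    (hG0 : ∀ (L : ℕ) [NeZero L], 3 ≤ L → ∀ hℓL : ℓw ≤ L,
      (fermionPartialTrace (PolySite.toTorusEmb L (injOn_proj_of_subset_halfOpenBox' hΛ hℓL))
        ((partitionFn βh (hubbardTorusTT' L t 0 U - (μ : ℂ) • totalNumber))⁻¹ •
          gibbsWeight βh (hubbardTorusTT' L t 0 U - (μ : ℂ) • totalNumber)) * G).trace = 0)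
    {LB : FermionOp (Λ.erase a)} (hLB : LB.IsHermitian) {c : ℝ}
    (hcert : ((Real.exp c : ℂ) • cfc Real.exp LB -
      fermionPartialTrace (PolySite.incl (Finset.erase_subset a Λ))
        (cfc Real.exp (-((βh : ℂ) • (clusterHamiltonian Λ t U J V μ' + G)) +
          fermionEmbed (PolySite.incl (Finset.erase_subset a Λ)) LB))).PosSemidef)
    {ε : ℝ} (hε : 0 < ε) :
    ∀ᶠ j in atTop, Real.log (partitionFn βh (sectorHamiltonianTT' t 0 U n (Ls j))).re ≤
      (c - βh * μ * n + ε) * (Ls j : ℝ) ^ 2 := by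
  -- the uniform bound on the window energy
  have hWherm : (clusterHamiltonian Λ t U J V μ' + G).IsHermitian := (isHermitian_clusterHamiltonian Λ t U J V μ').add hG
  obtain ⟨E, hE⟩ := exists_abs_re_trace_mul_density_le hWherm
  -- the linear finite-volume bound, `C = 2 ℓw (log 4 + |c| + |βh| E)`
  refine eventually_log_partitionFn_sectorHamiltonianTT'_le_of_linear t 0 U μ βh hn0 hn2 hLs
    (c := c) (C := 2 * (ℓw : ℝ) * (Real.log 4 + |c| + |βh| * |E|)) (L₀ := max 3 ℓw) (fun L hL => ?_) hε
  have hL3 : 3 ≤ L := le_of_max_le_left hL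
  have hLw : ℓw ≤ L := le_of_max_le_right hL
  haveI : NeZero L := ⟨by omega⟩
  have hM0 := hubbardTTPrime_zero_log_partitionFn_le_of_clusterCertificate t U μ βh hL3 ha hmax hΛ hLw hJ hV hμ hG
    (hG0 L hL3 hLw) hLB hcert
  set e : ℝ := (fermionPartialTrace (PolySite.toTorusEmb L (injOn_proj_of_subset_halfOpenBox' hΛ hLw))
      ((partitionFn βh (hubbardTorusTT' L t 0 U - (μ : ℂ) • totalNumber))⁻¹ •
        gibbsWeight βh (hubbardTorusTT' L t 0 U - (μ : ℂ) • totalNumber)) *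
      (clusterHamiltonian Λ t U J V μ' + G)).trace.re with hedef
  have heE : |e| ≤ E := by
    rw [hedef]
    haveI : Nonempty (Finset (Orb (FermionTorus 2 L))) := ⟨∅⟩
    have hK : (hubbardTorusTT' L t 0 U - (μ : ℂ) • totalNumber).IsHermitian := by
      rw [hubbardTorusTT'_zero_sub_mu]
      exact isHermitian_hubbardTorusWith_dim t U μ
    refine hE _ (posSemidef_fermionPartialTrace _ (hK.posSemidef_gibbsDensity βh)) ?_
    rw [trace_fermionPartialTrace, trace_gibbsDensity _ _ (partitionFn_pos βh hK).ne']
  -- `0 ≤ L² − (L+1−ℓw)² ≤ 2 ℓw L` and the factor `log 4 − c − βh e` is at most `log 4 + |c| + |βh| E`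
  have hℓw : 1 ≤ ℓw := by
    have := mem_halfOpenBox.1 (hΛ ha) 0
    omega
  have hsub : ((L + 1 - ℓw : ℕ) : ℝ) = (L : ℝ) + 1 - (ℓw : ℝ) := by
    rw [Nat.cast_sub (by omega)]
    push_cast
    ring
  have hℓr : (1 : ℝ) ≤ (ℓw : ℝ) := by exact_mod_cast hℓw
  have hLr : (ℓw : ℝ) ≤ (L : ℝ) := by exact_mod_cast hLw
  have hN1 : ((L ^ 2 : ℕ) : ℝ) - (((L + 1 - ℓw) ^ 2 : ℕ) : ℝ) ≤ 2 * (ℓw : ℝ) * (L : ℝ) := by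
    push_cast
    rw [hsub]
    nlinarith
  have hN0 : 0 ≤ ((L ^ 2 : ℕ) : ℝ) - (((L + 1 - ℓw) ^ 2 : ℕ) : ℝ) := by
    push_cast
    rw [hsub]
    nlinarith
  have hfac : Real.log 4 - c - βh * e ≤ Real.log 4 + |c| + |βh| * |E| := by
    have h2 : -(βh * e) ≤ |βh| * |E| := (neg_le_abs _).trans
      ((abs_mul βh e).le.trans (mul_le_mul_of_nonneg_left (heE.trans (le_abs_self E)) (abs_nonneg _)))
    linarith [neg_le_abs c]
  have hlog4 : 0 ≤ Real.log 4 := Real.log_nonneg (by norm_num)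
  have hbd : (((L ^ 2 : ℕ) : ℝ) - (((L + 1 - ℓw) ^ 2 : ℕ) : ℝ)) * (Real.log 4 - c - βh * e) ≤
      2 * (ℓw : ℝ) * (L : ℝ) * (Real.log 4 + |c| + |βh| * |E|) :=
    (mul_le_mul_of_nonneg_left hfac hN0).trans (mul_le_mul_of_nonneg_right hN1 (by positivity))
  have hM' : Real.log (partitionFn βh (hubbardTorusTT' L t 0 U - (μ : ℂ) • totalNumber)).re ≤
      ((L : ℝ) ^ 2) * c + (((L ^ 2 : ℕ) : ℝ) - (((L + 1 - ℓw) ^ 2 : ℕ) : ℝ)) * (Real.log 4 - c - βh * e) := by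
    rw [hedef]
    exact hM0
  nlinarith [hM', hbd]

/-! ### §3. The cold input: the zero-entropy free-energy bound in the thermodynamic limit -/

/-- `halfRectN n L ≤ L² = #sites` for `0 ≤ n ≤ 2`. [cite: Ruelle1969, §3.4] -/
private theorem halfRectN_le_card' {n : ℝ} (hn0 : 0 ≤ n) (hn2 : n ≤ 2) (L : ℕ) :
    halfRectN n L ≤ Fintype.card (FermionTorus 2 L) := by
  have h := ThermodynamicLimit.rectN_le_two_mul hn0 hn2 L
  have hcard : Fintype.card (FermionTorus 2 L) = L * L := by simp [FermionTorus, sq]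
  rw [hcard]
  exact Nat.le_of_mul_le_mul_left h two_pos

/-- **The ground energy of the sector Hamiltonian is at most the `rectN n L`-particle ground energy**
(in fact equal): `E₀(H_L|_{sector}) ≤ E₀(H_L; rectN n L)`. [cite: Tasaki2020, §2.2] -/
theorem groundEnergy_sectorHamiltonianTT'_le (t t' U : ℝ) {n : ℝ} (hn0 : 0 ≤ n) (hn2 : n ≤ 2)
    (L : ℕ) [NeZero L] :
    (sectorHamiltonianTT' t t' U n L).groundEnergy ≤ groundEnergy (hubbardTorusTT' L t t' U) (rectN n L) := by
  have hA : (hubbardTorusTT' L t t' U).IsHermitian := hubbardTorusTT'_isHermitian L t t' U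
  have hinv : ∀ s s', ¬ szConfig n L s → szConfig n L s' → hubbardTorusTT' L t t' U s s' = 0 :=
    fun s s' hs hs' => hubbardTorusTT'_apply_eq_zero_of_szConfig L t t' U n s s' hs hs'
  have hp : ∃ s, szConfig n L s := exists_szConfig hn0 hn2 L
  have hK : ∀ v : Fock (Orb (FermionTorus 2 L)), v ∈ szSector (rectN n L) (0 : ℝ) ↔
      ∀ s, ¬ szConfig n L s → v s = 0 := mem_szSector_rectN_iff n L
  have h := groundEnergy_submatrix_le_minEnergyOn (szConfig n L) hA hinv hp (szSector (rectN n L) 0) hK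
  have hGS : (hubbardTorusTT' L t t' U).minEnergyOn (szSector (rectN n L) 0) =
      groundEnergy (hubbardTorusTT' L t t' U) (rectN n L) := by
    rw [show rectN n L = 2 * halfRectN n L from rfl,
      groundEnergy_hubbardTorusTT'_eq_minEnergyOn_szSector L t t' U (halfRectN_le_card' hn0 hn2 L)]
  rw [hGS] at h
  convert h using 2
  rfl

/-- **The zero-entropy cold input in the thermodynamic limit.** For `U ≥ 0`, `0 ≤ n < 2`, `β ≥ 0`,
`Ls → ∞` and `ε > 0`, eventually `−β (e(t,t',U,n) + ε) (Ls j)² ≤ log Z_β(sectorHamiltonianTT' t t' U n (Ls j))`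
(`Z_β ≥ e^{−β E₀}`, `E₀(sector) ≤ E₀(rectN n L)`, `E₀(L)/L² → e` = `tendsto_energyDensityTT'_torus`): the
hypothesis `hℓ` of the chord theorems with `ℓ = −β (e + ε)`.
[cite: GustafsonSigal2003, §18.3 Theorem 18.10] [cite: Ruelle1969, §3.4] -/
theorem eventually_neg_mul_le_log_partitionFn_sectorHamiltonianTT' (t t' : ℝ) {U : ℝ} (hU : 0 ≤ U)
    {n : ℝ} (hn0 : 0 ≤ n) (hn2 : n < 2) {β : ℝ} (hβ : 0 ≤ β) {Ls : ℕ → ℕ} (hLs : Tendsto Ls atTop atTop)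
    {ε : ℝ} (hε : 0 < ε) :
    ∀ᶠ j in atTop, -(β * (energyDensityTT' t t' U n + ε)) * (Ls j : ℝ) ^ 2 ≤
      Real.log (partitionFn β (sectorHamiltonianTT' t t' U n (Ls j))).re := by
  have hT := (tendsto_energyDensityTT'_torus t t' hU hn0 hn2).comp hLs
  have hev : ∀ᶠ j in atTop, groundEnergy (hubbardTorusTT' (Ls j) t t' U) (rectN n (Ls j)) / (Ls j : ℝ) ^ 2 <
      energyDensityTT' t t' U n + ε :=
    hT.eventually (Iio_mem_nhds (lt_add_of_pos_right _ hε))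
  filter_upwards [hev, hLs.eventually_ge_atTop 1] with j hj hj1
  haveI : NeZero (Ls j) := ⟨by omega⟩
  haveI := nonempty_szConfig hn0 hn2.le (Ls j)
  have hL2 : (0 : ℝ) < (Ls j : ℝ) ^ 2 := by positivity
  have h1 := (isHermitian_sectorHamiltonianTT' t t' U n (Ls j)).neg_log_partitionFn_le_mul_groundEnergy β
  have h2 := groundEnergy_sectorHamiltonianTT'_le t t' U hn0 hn2.le (Ls j)
  have h3 := (div_lt_iff₀ hL2).1 hj
  nlinarith [mul_le_mul_of_nonneg_left (h2.trans h3.le) hβ]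

/-! ### §4. Headlines: certified upper edges of the thermal energy window -/

namespace InfVolFermionState

variable {t t' U n β : ℝ} {ω : InfVolFermionState 2} {Ls : ℕ → ℕ}

/-- **Hot chord with the cold input discharged.** For every torus limit `ω` of the canonical sector Gibbs
states of the `t–t'` Hubbard model (`U ≥ 0`, `0 ≤ n < 2`) at `β` along `Ls → ∞`, every `0 < β_h < β`, every
eventual hot bound `log Z_{β_h}^{sector}(Ls j) ≤ (u + ε)(Ls j)²` (all `ε > 0`) and every upper bound
`e(t,t',U,n) ≤ e⁺` on the ground-state energy density: `e_Φ(ω) ≤ (u + β e⁺)/(β − β_h)`.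
[cite: Israel1979, Lemma II.3.1] [cite: Ruelle1969, §3.4] -/
theorem IsTorusLimitOfMixture.meanEnergy_hubbardTTPrime_le_of_eventually_hot_of_energyDensityTT'_le
    (hU : 0 ≤ U) (hn0 : 0 ≤ n) (hn2 : n < 2)
    (h : ω.IsTorusLimitOfMixture (sectorGibbsCount n) (fun L => sectorGibbsWeightTT' β t t' U n L)
      (fun L => sectorGibbsVectorTT' t t' U n L) Ls)
    (hLs : Tendsto Ls atTop atTop) {βh u : ℝ} (hβh : 0 < βh) (hlt : βh < β)
    (hu : ∀ ε : ℝ, 0 < ε → ∀ᶠ j in atTop,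
      Real.log (partitionFn βh (sectorHamiltonianTT' t t' U n (Ls j))).re ≤ (u + ε) * (Ls j : ℝ) ^ 2)
    {eup : ℝ} (he : energyDensityTT' t t' U n ≤ eup) :
    ω.meanEnergy (hubbardTTPrimeFermionInteraction t t' U) 1 ≤ (u + β * eup) / (β - βh) := by
  have hβ : 0 < β := hβh.trans hlt
  have hmain : ω.meanEnergy (hubbardTTPrimeFermionInteraction t t' U) 1 ≤
      (u + β * energyDensityTT' t t' U n) / (β - βh) := by
    refine le_of_forall_pos_le_add fun δ hδ => ?_
    have hε : 0 < δ * (β - βh) / (1 + β) := by have := sub_pos.2 hlt; positivity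
    have hℓ := eventually_neg_mul_le_log_partitionFn_sectorHamiltonianTT' t t' hU hn0 hn2 hβ.le hLs hε
    refine (IsTorusLimitOfMixture.meanEnergy_hubbardTTPrime_le_chord_of_sectorGibbs hn0 hn2.le h hLs hβh hlt
      hℓ (hu _ hε)).trans (le_of_eq ?_)
    have hd : β - βh ≠ 0 := (sub_pos.2 hlt).ne'
    field_simp
    ring
  refine hmain.trans ?_
  rw [div_le_div_iff_of_pos_right (sub_pos.2 hlt)]
  nlinarith [mul_le_mul_of_nonneg_left he hβ.le]

/-- **Certified upper edge from a Markov certificate (`E_Φ` representative, every `t'`) and a `T = 0`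
row.** With `ω`, `Ls`, `n`, `U ≥ 0` as above, a Markov certificate `(Λ, a, z, x, G, L_B, c)` at
`(β_h, μ)` as in `eventually_log_partitionFn_sectorHamiltonianTT'_le_of_certificate`
(`HubbardTorusMarkovPressureTorusLimit.lean`) and `e(t,t',U,n) ≤ e⁺`:
`e_Φ(ω) ≤ (c − β_h μ n + β e⁺)/(β − β_h)`. [cite: PoulinHastings2011, eqs. (3)–(8)]
[cite: GustafsonSigal2003, §18.3 Theorem 18.10] -/
theorem IsTorusLimitOfMixture.meanEnergy_hubbardTTPrime_le_of_markov_certificate_of_energyDensityTT'_le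
    (hU : 0 ≤ U) (hn0 : 0 ≤ n) (hn2 : n < 2)
    (h : ω.IsTorusLimitOfMixture (sectorGibbsCount n) (fun L => sectorGibbsWeightTT' β t t' U n L)
      (fun L => sectorGibbsVectorTT' t t' U n L) Ls)
    (hLs : Tendsto Ls atTop atTop) {βh : ℝ} (hβh : 0 < βh) (hlt : βh < β)
    (μ : ℝ) {Λ : Finset (Site 2)} {a : Site 2} (ha : a ∈ Λ) (hmax : ∀ y ∈ Λ, toLex y ≤ toLex a)
    {ℓw : ℕ} (hΛ : Λ ⊆ halfOpenBox 2 ℓw)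
    {z : Site 2} (hz : shiftSet z (thicken ({0} : Finset (Site 2)) 1) ⊆ Λ) {x : Site 2} (hx : x ∈ Λ)
    {G : FermionOp Λ} (hG : G.IsHermitian)
    (hG0 : ∀ (L : ℕ) [NeZero L], 3 ≤ L → ∀ hℓL : ℓw ≤ L,
      (fermionPartialTrace (PolySite.toTorusEmb L (injOn_proj_of_subset_halfOpenBox' hΛ hℓL))
        ((partitionFn βh (hubbardTorusTT' L t t' U - (μ : ℂ) • totalNumber))⁻¹ •
          gibbsWeight βh (hubbardTorusTT' L t t' U - (μ : ℂ) • totalNumber)) * G).trace = 0)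
    {LB : FermionOp (Λ.erase a)} (hLB : LB.IsHermitian) {c : ℝ}
    (hcert : ((Real.exp c : ℂ) • cfc Real.exp LB -
      fermionPartialTrace (PolySite.incl (Finset.erase_subset a Λ))
        (cfc Real.exp (-((βh : ℂ) •
            (fermionEmbed (PolySite.incl hz) (fermionEmbed (PolySite.shiftEmb z (thicken ({0} : Finset (Site 2)) 1))
                ((hubbardTTPrimeFermionInteraction t t' U).meanEnergyObs 1))
              - (μ : ℂ) • (nAt x hx 0 + nAt x hx 1) + G)) +
          fermionEmbed (PolySite.incl (Finset.erase_subset a Λ)) LB))).PosSemidef)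
    {eup : ℝ} (he : energyDensityTT' t t' U n ≤ eup) :
    ω.meanEnergy (hubbardTTPrimeFermionInteraction t t' U) 1 ≤ (c - βh * μ * n + β * eup) / (β - βh) :=
  h.meanEnergy_hubbardTTPrime_le_of_eventually_hot_of_energyDensityTT'_le hU hn0 hn2 hLs hβh hlt
    (fun _ hε => eventually_log_partitionFn_sectorHamiltonianTT'_le_of_certificate t t' U μ βh hn0 hn2.le hLs ha hmax
      hΛ hz hx hG hG0 hLB hcert hε) he

/-- **Certified upper edge from a WEIGHTED-CLUSTER Markov certificate (`t' = 0`) and a `T = 0` row.**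
For every torus limit `ω` of the canonical sector Gibbs states of the square-lattice Hubbard model
(`U ≥ 0`, `0 ≤ n < 2`) at `β` along `Ls → ∞`, every `0 < β_h < β`, a weighted-cluster Markov certificate
`(Λ, a, J, V, μ', G, L_B, c)` at `(β_h, μ)` (window as small as a corner — the programme's `3 × 2`, `4 × 2`,
staircase shields) and a ground-state row `e(t,0,U,n) ≤ e⁺`: `e_Φ(ω) ≤ (c − β_h μ n + β e⁺)/(β − β_h)`
(at `(1,8,7/8)`, `β = 4`: the certified upper edge of the `T = t/4` thermal energy window).
[cite: PoulinHastings2011, eqs. (3)–(8)] [cite: GustafsonSigal2003, §18.3 Theorem 18.10] -/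
theorem IsTorusLimitOfMixture.meanEnergy_hubbardTTPrime_le_of_clusterMarkovCertificate
    (hU : 0 ≤ U) (hn0 : 0 ≤ n) (hn2 : n < 2)
    (h : ω.IsTorusLimitOfMixture (sectorGibbsCount n) (fun L => sectorGibbsWeightTT' β t 0 U n L)
      (fun L => sectorGibbsVectorTT' t 0 U n L) Ls)
    (hLs : Tendsto Ls atTop atTop) {βh : ℝ} (hβh : 0 < βh) (hlt : βh < β)
    (μ : ℝ) {Λ : Finset (Site 2)} {a : Site 2} (ha : a ∈ Λ) (hmax : ∀ y ∈ Λ, toLex y ≤ toLex a)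
    {ℓw : ℕ} (hΛ : Λ ⊆ halfOpenBox 2 ℓw)
    {J : Site 2 → Fin 2 → ℝ} {V μ' : Site 2 → ℝ}
    (hJ : ∀ i, bondWeightSum Λ J i = 1) (hV : siteWeightSum Λ V = 1) (hμ : siteWeightSum Λ μ' = -μ)
    {G : FermionOp Λ} (hG : G.IsHermitian)
    (hG0 : ∀ (L : ℕ) [NeZero L], 3 ≤ L → ∀ hℓL : ℓw ≤ L,
      (fermionPartialTrace (PolySite.toTorusEmb L (injOn_proj_of_subset_halfOpenBox' hΛ hℓL))
        ((partitionFn βh (hubbardTorusTT' L t 0 U - (μ : ℂ) • totalNumber))⁻¹ •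
          gibbsWeight βh (hubbardTorusTT' L t 0 U - (μ : ℂ) • totalNumber)) * G).trace = 0)
    {LB : FermionOp (Λ.erase a)} (hLB : LB.IsHermitian) {c : ℝ}
    (hcert : ((Real.exp c : ℂ) • cfc Real.exp LB -
      fermionPartialTrace (PolySite.incl (Finset.erase_subset a Λ))
        (cfc Real.exp (-((βh : ℂ) • (clusterHamiltonian Λ t U J V μ' + G)) +
          fermionEmbed (PolySite.incl (Finset.erase_subset a Λ)) LB))).PosSemidef)
    {eup : ℝ} (he : energyDensityTT' t 0 U n ≤ eup) :
    ω.meanEnergy (hubbardTTPrimeFermionInteraction t 0 U) 1 ≤ (c - βh * μ * n + β * eup) / (β - βh) :=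
  h.meanEnergy_hubbardTTPrime_le_of_eventually_hot_of_energyDensityTT'_le hU hn0 hn2 hLs hβh hlt
    (fun _ hε => eventually_log_partitionFn_sectorHamiltonianTT'_le_of_clusterCertificate t U μ βh hn0 hn2.le hLs
      ha hmax hΛ hJ hV hμ hG hG0 hLB hcert hε) he

/-- **The same with a structured annihilator** `G = windowAnnihilator s Λ S hS z hz O g` (Hermitian local
operators): the matrix certificate and the `T = 0` row are the ONLY hypotheses.
[cite: PoulinHastings2011, eqs. (3)–(8)] -/
theorem IsTorusLimitOfMixture.meanEnergy_hubbardTTPrime_le_of_clusterMarkovCertificate_annihilator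
    (hU : 0 ≤ U) (hn0 : 0 ≤ n) (hn2 : n < 2)
    (h : ω.IsTorusLimitOfMixture (sectorGibbsCount n) (fun L => sectorGibbsWeightTT' β t 0 U n L)
      (fun L => sectorGibbsVectorTT' t 0 U n L) Ls)
    (hLs : Tendsto Ls atTop atTop) {βh : ℝ} (hβh : 0 < βh) (hlt : βh < β)
    (μ : ℝ) {Λ : Finset (Site 2)} {a : Site 2} (ha : a ∈ Λ) (hmax : ∀ y ∈ Λ, toLex y ≤ toLex a)
    {ℓw : ℕ} (hΛ : Λ ⊆ halfOpenBox 2 ℓw)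
    {J : Site 2 → Fin 2 → ℝ} {V μ' : Site 2 → ℝ}
    (hJ : ∀ i, bondWeightSum Λ J i = 1) (hV : siteWeightSum Λ V = 1) (hμ : siteWeightSum Λ μ' = -μ)
    {ι : Type*} (s : Finset ι) (S : ι → Finset (Site 2)) (hS : ∀ i, S i ⊆ Λ) (z : ι → Site 2)
    (hz : ∀ i, shiftSet (z i) (S i) ⊆ Λ) {O : ∀ i, FermionOp (S i)} (hO : ∀ i ∈ s, (O i).IsHermitian)
    (g : ι → ℝ)
    {LB : FermionOp (Λ.erase a)} (hLB : LB.IsHermitian) {c : ℝ}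
    (hcert : ((Real.exp c : ℂ) • cfc Real.exp LB -
      fermionPartialTrace (PolySite.incl (Finset.erase_subset a Λ))
        (cfc Real.exp (-((βh : ℂ) • (clusterHamiltonian Λ t U J V μ' + windowAnnihilator s Λ S hS z hz O g)) +
          fermionEmbed (PolySite.incl (Finset.erase_subset a Λ)) LB))).PosSemidef)
    {eup : ℝ} (he : energyDensityTT' t 0 U n ≤ eup) :
    ω.meanEnergy (hubbardTTPrimeFermionInteraction t 0 U) 1 ≤ (c - βh * μ * n + β * eup) / (β - βh) := by
  refine h.meanEnergy_hubbardTTPrime_le_of_clusterMarkovCertificate hU hn0 hn2 hLs hβh hlt μ ha hmax hΛ hJ hV hμ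
    (isHermitian_windowAnnihilator s Λ S hS z hz hO g) (fun L _ hL3 hℓL => ?_) hLB hcert he
  have hKTI : ∀ w : TorusSite 2 L, relabel (Orb.translate w) (hubbardTorusTT' L t 0 U - (μ : ℂ) • totalNumber) =
      hubbardTorusTT' L t 0 U - (μ : ℂ) • totalNumber := fun w => by
    rw [hubbardTorusTT'_zero_sub_mu, relabel_translate_hubbardTorusWith]
  exact trace_window_mul_windowAnnihilator (relabel_translate_gibbsDensity L hKTI βh) _ s S hS z hz O g

/-- **Corner form with a structured annihilator** — the exact shape of the programme's C1 certificates
(`h_μ = cornerEnergyRep Λ a t U μ`, `G = windowAnnihilator …`, shield `Λ ∖ a`, constant `c = m`): for every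
torus limit `ω` of the sector Gibbs states at `β` (`t' = 0`, `U ≥ 0`, `0 ≤ n < 2`), `0 < β_h < β` and a
`T = 0` row `e(t,0,U,n) ≤ e⁺`: `e_Φ(ω) ≤ (c − β_h μ n + β e⁺)/(β − β_h)`.
[cite: PoulinHastings2011, eqs. (3)–(8)] [cite: GustafsonSigal2003, §18.3 Theorem 18.10] -/
theorem IsTorusLimitOfMixture.meanEnergy_hubbardTTPrime_le_of_cornerMarkovCertificate
    (hU : 0 ≤ U) (hn0 : 0 ≤ n) (hn2 : n < 2)
    (h : ω.IsTorusLimitOfMixture (sectorGibbsCount n) (fun L => sectorGibbsWeightTT' β t 0 U n L)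
      (fun L => sectorGibbsVectorTT' t 0 U n L) Ls)
    (hLs : Tendsto Ls atTop atTop) {βh : ℝ} (hβh : 0 < βh) (hlt : βh < β)
    (μ : ℝ) {Λ : Finset (Site 2)} {a : Site 2} (ha : a ∈ Λ) (hmax : ∀ y ∈ Λ, toLex y ≤ toLex a)
    (hcorner : ∀ i : Fin 2, a - unitVec i ∈ Λ) {ℓw : ℕ} (hΛ : Λ ⊆ halfOpenBox 2 ℓw)
    {ι : Type*} (s : Finset ι) (S : ι → Finset (Site 2)) (hS : ∀ i, S i ⊆ Λ) (z : ι → Site 2)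
    (hz : ∀ i, shiftSet (z i) (S i) ⊆ Λ) {O : ∀ i, FermionOp (S i)} (hO : ∀ i ∈ s, (O i).IsHermitian)
    (g : ι → ℝ)
    {LB : FermionOp (Λ.erase a)} (hLB : LB.IsHermitian) {c : ℝ}
    (hcert : ((Real.exp c : ℂ) • cfc Real.exp LB -
      fermionPartialTrace (PolySite.incl (Finset.erase_subset a Λ))
        (cfc Real.exp (-((βh : ℂ) • (cornerEnergyRep Λ a t U μ + windowAnnihilator s Λ S hS z hz O g)) +
          fermionEmbed (PolySite.incl (Finset.erase_subset a Λ)) LB))).PosSemidef)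
    {eup : ℝ} (he : energyDensityTT' t 0 U n ≤ eup) :
    ω.meanEnergy (hubbardTTPrimeFermionInteraction t 0 U) 1 ≤ (c - βh * μ * n + β * eup) / (β - βh) :=
  h.meanEnergy_hubbardTTPrime_le_of_clusterMarkovCertificate_annihilator hU hn0 hn2 hLs hβh hlt μ ha hmax hΛ
    (fun i => bondWeightSum_cornerBondWeight ha (hcorner i)) (siteWeightSum_cornerSiteWeight ha)
    (siteWeightSum_mul_cornerSiteWeight ha (-μ)) s S hS z hz hO g hLB hcert he

end InfVolFermionState

end Torus

end Literature.MathematicalPhysics.QuantumLattice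

end
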